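import Literature.AlgebraicGeometry.ModuliOfAbelianVarieties.SymplecticSimilitudeGroup
import HarnessLib

/-!
# Transport of `GSp(E)` / `Sp(E)` along a change of basis, and the type-`δ` form as a conjugate of Mathlib's `J`

Topic `AlgebraicGeometry/ModuliOfAbelianVarieties`; namespace `Literature.AlgebraicGeometry.ModuliOfAbelianVarieties`.
THEOREMS ONLY over ★ (σ1) `SymplecticSimilitudeGroup` (`IsMultiplier E g ν : gᵀ E g = ν • E`, `similitudeGroupOfForm E`,
`symplecticGroupOfForm E`, `typeFormOver δ R = E_δ = (0 Δ; -Δ 0)`); no definition, no named fact, no instance, no `sorry`.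

§1 (any Gram matrix `E` over a commutative ring `R`, any `P ∈ GL_n(R)`): the form `Pᵀ E P` (= `E` in the basis given by
the columns of `P`) has `GSp(Pᵀ E P) = P⁻¹ · GSp(E) · P` with the SAME multipliers, and `Sp(Pᵀ E P) = P⁻¹ · Sp(E) · P`
(`isMultiplier_transpose_mul_mul_iff`, `mem_similitudeGroupOfForm_transpose_mul_mul_iff`,
`similitudeGroupOfForm_transpose_mul_mul`, and the `symplecticGroupOfForm` twins); `GSp`/`Sp` do not see `E ↦ -E`,
`E ↦ Eᵀ`.

§2 (type `δ`): over any commutative ring `R` in which the integers `δ i` are units (every `ℚ`-algebra when `0 < δ i`),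
the block matrix `P_δ = diag(1_g, Δ)` is invertible and `E_δ = P_δᵀ Jᵀ P_δ` for Mathlib's `J = (0 -1; 1 0)`
(`typeFormOver_eq_transpose_mul_J_transpose_mul`); hence **`Sp(E_δ)(R) = P_δ⁻¹ · Sp(J)(R) · P_δ`** and
**`GSp(E_δ)(R) = P_δ⁻¹ · GSp(J)(R) · P_δ`** (`symplecticGroupOfForm_typeFormOver_eq_map_conj`,
`similitudeGroupOfForm_typeFormOver_eq_map_conj`), with the matrix-level reading against Mathlib's
`Matrix.symplecticGroup` (`mem_symplecticGroupOfForm_typeFormOver_iff_conj_mem_symplecticGroup`), and `P_δ` over `S`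
is the image of `P_δ` over `R` under `GL_{2g}(f)` (`generalLinearGroup_map_coe_eq_fromBlocks`), so statements proved for
Mathlib's standard symplectic group (e.g. strong approximation for `Sp_{2g}`) transport to the tree's `gspRational δ` /
`gspFinAdelic δ` / `gspReal δ`.

Printed anchor: [Milne2005ShimuraVarieties] §6 p. 67 («`GSp(ψ)`, `Sp(ψ)` for a symplectic space `(V, ψ)`» — a notion of
the FORM, independent of the basis; a symplectic basis identifies `Sp(ψ)` with `Sp_{2g}`); [Lange2023AbelianVarietiesComplex]
§3.1.2 (3.4) («`E_δ = diag(1,Δ)(0 1; -1 0)diag(1,Δ)`», the tree's ℝ-only ★ `SiegelModuli.typeForm_map_eq`).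
Cell `hodgecm-mathlib`, #60 road (A-p05 TABLE v1.1, item R60-8b «δ-form transport»); banked generic leaf, books 0.
HC_CM is proved only modulo the 7 printed citations until rung 0 closes.

## References
* [Milne2005ShimuraVarieties] J. S. Milne, *Introduction to Shimura varieties* (2005), §6 p. 67.
* [Lange2023AbelianVarietiesComplex] H. Lange, *Abelian Varieties over the Complex Numbers* (2023), §3.1.2 (3.4).
-/

set_option autoImplicit false

noncomputable section

open Matrix

namespace Literature.AlgebraicGeometry.ModuliOfAbelianVarieties

/-! ### §1. Change of basis for an arbitrary Gram matrix -/

section General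

variable {R : Type*} [CommRing R] {n : Type*} [Fintype n] [DecidableEq n]

/-- `A ↦ Pᵀ A P` is injective for `P ∈ GL_n(R)`. [cite: Milne2005ShimuraVarieties, §6 p. 67] -/
theorem transpose_mul_mul_eq_transpose_mul_mul_iff (P : GL n R) {A B : Matrix n n R} :
    (P : Matrix n n R)ᵀ * A * (P : Matrix n n R) = (P : Matrix n n R)ᵀ * B * (P : Matrix n n R) ↔ A = B := by
  refine ⟨fun h => ?_, fun h => by rw [h]⟩
  have hP : (P : Matrix n n R) * ((P⁻¹ : GL n R) : Matrix n n R) = 1 := Units.mul_inv P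
  have hPt : (((P⁻¹ : GL n R) : Matrix n n R))ᵀ * (P : Matrix n n R)ᵀ = 1 := by
    rw [← Matrix.transpose_mul, hP, Matrix.transpose_one]
  have key : ∀ C : Matrix n n R,
      (((P⁻¹ : GL n R) : Matrix n n R))ᵀ * ((P : Matrix n n R)ᵀ * C * (P : Matrix n n R)) *
        ((P⁻¹ : GL n R) : Matrix n n R) = C := by
    intro C
    calc (((P⁻¹ : GL n R) : Matrix n n R))ᵀ * ((P : Matrix n n R)ᵀ * C * (P : Matrix n n R)) *
          ((P⁻¹ : GL n R) : Matrix n n R)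
        = ((((P⁻¹ : GL n R) : Matrix n n R))ᵀ * (P : Matrix n n R)ᵀ) * C *
            ((P : Matrix n n R) * ((P⁻¹ : GL n R) : Matrix n n R)) := by
          simp only [Matrix.mul_assoc]
      _ = C := by rw [hPt, hP, Matrix.one_mul, Matrix.mul_one]
  rw [← key A, ← key B, h]

/-- **Transport of multipliers along a change of basis**: `ν` is a multiplier of `g` for the form `Pᵀ E P` iff it is a
multiplier of `P g P⁻¹` for `E` (`(PgP⁻¹)ᵀ E (PgP⁻¹) = ν E ⟺ (Pg)ᵀ E (Pg) = ν Pᵀ E P`).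
[cite: Milne2005ShimuraVarieties, §6 p. 67] -/
theorem isMultiplier_transpose_mul_mul_iff (E : Matrix n n R) (P g : GL n R) (ν : Rˣ) :
    IsMultiplier ((P : Matrix n n R)ᵀ * E * (P : Matrix n n R)) g ν ↔ IsMultiplier E (P * g * P⁻¹) ν := by
  rw [isMultiplier_iff, isMultiplier_iff, ← transpose_mul_mul_eq_transpose_mul_mul_iff P
    (A := ((P * g * P⁻¹ : GL n R) : Matrix n n R)ᵀ * E * ((P * g * P⁻¹ : GL n R) : Matrix n n R))]
  have hP : ((P⁻¹ : GL n R) : Matrix n n R) * (P : Matrix n n R) = 1 := Units.inv_mul P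
  have h1 : ((P * g * P⁻¹ : GL n R) : Matrix n n R) * (P : Matrix n n R) = (P : Matrix n n R) * (g : Matrix n n R) := by
    rw [Units.val_mul, Units.val_mul, Matrix.mul_assoc, hP, Matrix.mul_one]
  have h2 : (P : Matrix n n R)ᵀ * ((P * g * P⁻¹ : GL n R) : Matrix n n R)ᵀ =
      ((P : Matrix n n R) * (g : Matrix n n R))ᵀ := by
    rw [← Matrix.transpose_mul, h1]
  have lhs : (P : Matrix n n R)ᵀ * (((P * g * P⁻¹ : GL n R) : Matrix n n R)ᵀ * E *
        ((P * g * P⁻¹ : GL n R) : Matrix n n R)) * (P : Matrix n n R) =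
      (g : Matrix n n R)ᵀ * ((P : Matrix n n R)ᵀ * E * (P : Matrix n n R)) * (g : Matrix n n R) := by
    calc (P : Matrix n n R)ᵀ * (((P * g * P⁻¹ : GL n R) : Matrix n n R)ᵀ * E *
            ((P * g * P⁻¹ : GL n R) : Matrix n n R)) * (P : Matrix n n R)
        = ((P : Matrix n n R)ᵀ * ((P * g * P⁻¹ : GL n R) : Matrix n n R)ᵀ) * E *
            (((P * g * P⁻¹ : GL n R) : Matrix n n R) * (P : Matrix n n R)) := by
          simp only [Matrix.mul_assoc]
      _ = (g : Matrix n n R)ᵀ * ((P : Matrix n n R)ᵀ * E * (P : Matrix n n R)) * (g : Matrix n n R) := by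
          rw [h2, h1, Matrix.transpose_mul]
          simp only [Matrix.mul_assoc]
  rw [lhs, Matrix.mul_smul, Matrix.smul_mul]

/-- **`g ∈ GSp(Pᵀ E P) ↔ P g P⁻¹ ∈ GSp(E)`.** [cite: Milne2005ShimuraVarieties, §6 p. 67] -/
theorem mem_similitudeGroupOfForm_transpose_mul_mul_iff (E : Matrix n n R) (P g : GL n R) :
    g ∈ similitudeGroupOfForm ((P : Matrix n n R)ᵀ * E * (P : Matrix n n R)) ↔
      P * g * P⁻¹ ∈ similitudeGroupOfForm E := by
  change (∃ ν : Rˣ, IsMultiplier _ g ν) ↔ ∃ ν : Rˣ, IsMultiplier E _ ν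
  simp only [isMultiplier_transpose_mul_mul_iff]

/-- **`g ∈ Sp(Pᵀ E P) ↔ P g P⁻¹ ∈ Sp(E)`.** [cite: Milne2005ShimuraVarieties, §6 p. 67] -/
theorem mem_symplecticGroupOfForm_transpose_mul_mul_iff (E : Matrix n n R) (P g : GL n R) :
    g ∈ symplecticGroupOfForm ((P : Matrix n n R)ᵀ * E * (P : Matrix n n R)) ↔
      P * g * P⁻¹ ∈ symplecticGroupOfForm E := by
  change IsMultiplier _ g 1 ↔ IsMultiplier E _ 1
  exact isMultiplier_transpose_mul_mul_iff E P g 1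

/-- Membership in the conjugate subgroup `P⁻¹ H P = H.map (conj P⁻¹)`: `g ∈ P⁻¹ H P ↔ P g P⁻¹ ∈ H` (how the
right-hand sides below are read). [cite: Milne2005ShimuraVarieties, §6 p. 67] -/
theorem mem_map_conj_inv_iff {G : Type*} [Group G] (H : Subgroup G) (P g : G) :
    g ∈ H.map (MulAut.conj P⁻¹).toMonoidHom ↔ P * g * P⁻¹ ∈ H := by
  rw [Subgroup.mem_map_equiv, MulAut.conj_symm_apply, inv_inv]

/-- **`GSp(Pᵀ E P) = P⁻¹ · GSp(E) · P`** as subgroups of `GL_n(R)`. [cite: Milne2005ShimuraVarieties, §6 p. 67] -/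
theorem similitudeGroupOfForm_transpose_mul_mul (E : Matrix n n R) (P : GL n R) :
    similitudeGroupOfForm ((P : Matrix n n R)ᵀ * E * (P : Matrix n n R)) =
      (similitudeGroupOfForm E).map (MulAut.conj P⁻¹).toMonoidHom := by
  ext g
  rw [mem_similitudeGroupOfForm_transpose_mul_mul_iff, mem_map_conj_inv_iff]

/-- **`Sp(Pᵀ E P) = P⁻¹ · Sp(E) · P`** as subgroups of `GL_n(R)`. [cite: Milne2005ShimuraVarieties, §6 p. 67] -/
theorem symplecticGroupOfForm_transpose_mul_mul (E : Matrix n n R) (P : GL n R) :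
    symplecticGroupOfForm ((P : Matrix n n R)ᵀ * E * (P : Matrix n n R)) =
      (symplecticGroupOfForm E).map (MulAut.conj P⁻¹).toMonoidHom := by
  ext g
  rw [mem_symplecticGroupOfForm_transpose_mul_mul_iff, mem_map_conj_inv_iff]

/-- Multipliers do not see `E ↦ -E`. [cite: Milne2005ShimuraVarieties, §6 p. 67] -/
theorem isMultiplier_neg_iff (E : Matrix n n R) (g : GL n R) (ν : Rˣ) :
    IsMultiplier (-E) g ν ↔ IsMultiplier E g ν := by
  rw [isMultiplier_iff, isMultiplier_iff, Matrix.mul_neg, Matrix.neg_mul, smul_neg, neg_inj]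

/-- Multipliers do not see `E ↦ Eᵀ` (`gᵀ Eᵀ g = (gᵀ E g)ᵀ`). [cite: Milne2005ShimuraVarieties, §6 p. 67] -/
theorem isMultiplier_transpose_iff (E : Matrix n n R) (g : GL n R) (ν : Rˣ) :
    IsMultiplier Eᵀ g ν ↔ IsMultiplier E g ν := by
  rw [isMultiplier_iff, isMultiplier_iff]
  have h : (g : Matrix n n R)ᵀ * Eᵀ * (g : Matrix n n R) = ((g : Matrix n n R)ᵀ * E * (g : Matrix n n R))ᵀ := by
    rw [Matrix.transpose_mul, Matrix.transpose_mul, Matrix.transpose_transpose, Matrix.mul_assoc]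
  rw [h, ← Matrix.transpose_smul]
  exact ⟨fun h' => by simpa using congrArg Matrix.transpose h', fun h' => by rw [h']⟩

/-- `GSp(-E) = GSp(E)`. [cite: Milne2005ShimuraVarieties, §6 p. 67] -/
theorem similitudeGroupOfForm_neg (E : Matrix n n R) : similitudeGroupOfForm (-E) = similitudeGroupOfForm E := by
  ext g
  change (∃ ν : Rˣ, IsMultiplier _ g ν) ↔ ∃ ν : Rˣ, IsMultiplier E g ν
  simp only [isMultiplier_neg_iff]

/-- `Sp(-E) = Sp(E)`. [cite: Milne2005ShimuraVarieties, §6 p. 67] -/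
theorem symplecticGroupOfForm_neg (E : Matrix n n R) : symplecticGroupOfForm (-E) = symplecticGroupOfForm E := by
  ext g
  exact isMultiplier_neg_iff E g 1

/-- `GSp(Eᵀ) = GSp(E)`. [cite: Milne2005ShimuraVarieties, §6 p. 67] -/
theorem similitudeGroupOfForm_transpose (E : Matrix n n R) : similitudeGroupOfForm Eᵀ = similitudeGroupOfForm E := by
  ext g
  change (∃ ν : Rˣ, IsMultiplier _ g ν) ↔ ∃ ν : Rˣ, IsMultiplier E g ν
  simp only [isMultiplier_transpose_iff]

/-- `Sp(Eᵀ) = Sp(E)`. [cite: Milne2005ShimuraVarieties, §6 p. 67] -/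
theorem symplecticGroupOfForm_transpose (E : Matrix n n R) : symplecticGroupOfForm Eᵀ = symplecticGroupOfForm E := by
  ext g
  exact isMultiplier_transpose_iff E g 1

end General

/-! ### §2. The type-`δ` form is `P_δᵀ Jᵀ P_δ`, `P_δ = diag(1_g, Δ)` -/

section TypeDelta

variable {g : ℕ} {R : Type*} [CommRing R]

/-- `diag(1, Δ) diag(1, Δ⁻¹) = 1` for a unit family `u` (the entries of `Δ`). [folklore] -/
private theorem fromBlocks_one_diagonal_mul_inv (u : Fin g → Rˣ) :
    Matrix.fromBlocks (1 : Matrix (Fin g) (Fin g) R) 0 0 (Matrix.diagonal fun i => (u i : R)) *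
        Matrix.fromBlocks (1 : Matrix (Fin g) (Fin g) R) 0 0 (Matrix.diagonal fun i => ((u i)⁻¹ : Rˣ)) = 1 := by
  rw [Matrix.fromBlocks_multiply, ← Matrix.fromBlocks_one]
  simp only [Matrix.mul_one, Matrix.mul_zero, Matrix.zero_mul, add_zero, zero_add, Matrix.diagonal_mul_diagonal,
    Units.mul_inv, Matrix.diagonal_one]

/-- `diag(1, Δ⁻¹) diag(1, Δ) = 1`. [folklore] -/
private theorem fromBlocks_one_diagonal_inv_mul (u : Fin g → Rˣ) :
    Matrix.fromBlocks (1 : Matrix (Fin g) (Fin g) R) 0 0 (Matrix.diagonal fun i => ((u i)⁻¹ : Rˣ)) *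
        Matrix.fromBlocks (1 : Matrix (Fin g) (Fin g) R) 0 0 (Matrix.diagonal fun i => (u i : R)) = 1 := by
  rw [Matrix.fromBlocks_multiply, ← Matrix.fromBlocks_one]
  simp only [Matrix.mul_one, Matrix.mul_zero, Matrix.zero_mul, add_zero, zero_add, Matrix.diagonal_mul_diagonal,
    Units.inv_mul, Matrix.diagonal_one]

/-- **`E_δ = P_δᵀ Jᵀ P_δ`** over any commutative ring `R`, where `P_δ = diag(1_g, Δ)` with `Δ = diag(δ)` cast to `R` and
`J = (0 -1; 1 0)` is Mathlib's `Matrix.J` (so `Jᵀ = -J = (0 1; -1 0)` is Lange's normal form).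
[cite: Lange2023AbelianVarietiesComplex, §3.1.2 (3.4)] -/
theorem typeFormOver_eq_transpose_mul_J_transpose_mul (δ : Fin g → ℕ) :
    typeFormOver δ R =
      (Matrix.fromBlocks (1 : Matrix (Fin g) (Fin g) R) 0 0 (Matrix.diagonal fun i => (δ i : R)))ᵀ *
        (Matrix.J (Fin g) R)ᵀ *
        Matrix.fromBlocks (1 : Matrix (Fin g) (Fin g) R) 0 0 (Matrix.diagonal fun i => (δ i : R)) := by
  rw [Matrix.J_transpose, Matrix.J, Matrix.fromBlocks_transpose, Matrix.fromBlocks_neg, Matrix.fromBlocks_multiply,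
    Matrix.fromBlocks_multiply]
  ext i j
  rcases i with i | i <;> rcases j with j | j <;>
    simp [typeFormOver_apply, typeForm, Matrix.fromBlocks, Matrix.diagonal_transpose, Matrix.diagonal_apply]

variable (R)

/-- **`Sp(E_δ)(R) = P_δ⁻¹ · Sp(J)(R) · P_δ`**: for a unit family `u` with `(u i : R) = δ i` (it exists iff the `δ i` are
units in `R` — every `ℚ`-algebra when `0 < δ i`) and `P_δ ∈ GL_{2g}(R)` the block matrix `diag(1_g, Δ)`, the tree's
type-`δ` symplectic group is the conjugate of the standard one by `P_δ`. [cite: Milne2005ShimuraVarieties, §6 p. 67]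
[cite: Lange2023AbelianVarietiesComplex, §3.1.2 (3.4)] -/
theorem symplecticGroupOfForm_typeFormOver_eq_map_conj (δ : Fin g → ℕ) (u : Fin g → Rˣ) (hu : ∀ i, (u i : R) = δ i)
    (P : GL (Fin g ⊕ Fin g) R)
    (hP : (P : Matrix (Fin g ⊕ Fin g) (Fin g ⊕ Fin g) R) =
      Matrix.fromBlocks (1 : Matrix (Fin g) (Fin g) R) 0 0 (Matrix.diagonal fun i => (u i : R))) :
    symplecticGroupOfForm (typeFormOver δ R) =
      (symplecticGroupOfForm (Matrix.J (Fin g) R)).map (MulAut.conj P⁻¹).toMonoidHom := by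
  have hE : typeFormOver δ R = (P : Matrix _ _ R)ᵀ * (Matrix.J (Fin g) R)ᵀ * (P : Matrix _ _ R) := by
    rw [typeFormOver_eq_transpose_mul_J_transpose_mul, hP]
    simp only [hu]
  rw [hE, symplecticGroupOfForm_transpose_mul_mul, symplecticGroupOfForm_transpose]

/-- **`GSp(E_δ)(R) = P_δ⁻¹ · GSp(J)(R) · P_δ`** (same `P_δ`); at `R = ℚ, 𝔸_{ℚ,f}, ℝ` the left side is the tree's
`gspRational δ`, `gspFinAdelic δ`, `gspReal δ`. [cite: Milne2005ShimuraVarieties, §6 p. 67]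
[cite: Lange2023AbelianVarietiesComplex, §3.1.2 (3.4)] -/
theorem similitudeGroupOfForm_typeFormOver_eq_map_conj (δ : Fin g → ℕ) (u : Fin g → Rˣ) (hu : ∀ i, (u i : R) = δ i)
    (P : GL (Fin g ⊕ Fin g) R)
    (hP : (P : Matrix (Fin g ⊕ Fin g) (Fin g ⊕ Fin g) R) =
      Matrix.fromBlocks (1 : Matrix (Fin g) (Fin g) R) 0 0 (Matrix.diagonal fun i => (u i : R))) :
    similitudeGroupOfForm (typeFormOver δ R) =
      (similitudeGroupOfForm (Matrix.J (Fin g) R)).map (MulAut.conj P⁻¹).toMonoidHom := by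
  have hE : typeFormOver δ R = (P : Matrix _ _ R)ᵀ * (Matrix.J (Fin g) R)ᵀ * (P : Matrix _ _ R) := by
    rw [typeFormOver_eq_transpose_mul_J_transpose_mul, hP]
    simp only [hu]
  rw [hE, similitudeGroupOfForm_transpose_mul_mul, similitudeGroupOfForm_transpose]

/-- **Matrix-level reading against Mathlib's `Matrix.symplecticGroup`**: `x ∈ Sp(E_δ)(R)` iff the matrix of
`P_δ x P_δ⁻¹` lies in `Matrix.symplecticGroup (Fin g) R`. [cite: Milne2005ShimuraVarieties, §6 p. 67] -/
theorem mem_symplecticGroupOfForm_typeFormOver_iff_conj_mem_symplecticGroup (δ : Fin g → ℕ) (u : Fin g → Rˣ)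
    (hu : ∀ i, (u i : R) = δ i) (P : GL (Fin g ⊕ Fin g) R)
    (hP : (P : Matrix (Fin g ⊕ Fin g) (Fin g ⊕ Fin g) R) =
      Matrix.fromBlocks (1 : Matrix (Fin g) (Fin g) R) 0 0 (Matrix.diagonal fun i => (u i : R)))
    (x : GL (Fin g ⊕ Fin g) R) :
    x ∈ symplecticGroupOfForm (typeFormOver δ R) ↔
      ((P * x * P⁻¹ : GL (Fin g ⊕ Fin g) R) : Matrix (Fin g ⊕ Fin g) (Fin g ⊕ Fin g) R) ∈
        Matrix.symplecticGroup (Fin g) R := by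
  rw [symplecticGroupOfForm_typeFormOver_eq_map_conj R δ u hu P hP, mem_map_conj_inv_iff,
    mem_symplecticGroupOfForm_J_iff]

/-- **Existence of `P_δ`** for a unit family `u`: there is `P ∈ GL_{2g}(R)` with matrix `diag(1_g, diag u)`.
[cite: Lange2023AbelianVarietiesComplex, §3.1.2 (3.4)] -/
theorem exists_generalLinearGroup_coe_eq_fromBlocks (u : Fin g → Rˣ) :
    ∃ P : GL (Fin g ⊕ Fin g) R, (P : Matrix (Fin g ⊕ Fin g) (Fin g ⊕ Fin g) R) =
      Matrix.fromBlocks (1 : Matrix (Fin g) (Fin g) R) 0 0 (Matrix.diagonal fun i => (u i : R)) :=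
  ⟨⟨_, _, fromBlocks_one_diagonal_mul_inv u, fromBlocks_one_diagonal_inv_mul u⟩, rfl⟩

/-- Over a `ℚ`-algebra the positive integers `δ i` are units, so the hypotheses of §2 are met (Lange's `diag(1, Δ)` is
invertible over `ℚ`). [cite: Lange2023AbelianVarietiesComplex, §3.1.2 (3.4)] -/
theorem exists_units_coe_eq_natCast [Algebra ℚ R] (δ : Fin g → ℕ) (hδ : ∀ i, 0 < δ i) :
    ∃ u : Fin g → Rˣ, ∀ i, (u i : R) = δ i := by
  refine ⟨fun i => Units.map (algebraMap ℚ R).toMonoidHom (Units.mk0 (δ i : ℚ) (by exact_mod_cast (hδ i).ne')),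
    fun i => ?_⟩
  simp

/-- **Packaged over a `ℚ`-algebra**: for a polarisation type with `0 < δ i` there is `P_δ ∈ GL_{2g}(R)` with matrix
`diag(1_g, Δ)` such that `Sp(E_δ)(R) = P_δ⁻¹ · Sp(J)(R) · P_δ` and `GSp(E_δ)(R) = P_δ⁻¹ · GSp(J)(R) · P_δ`.
[cite: Milne2005ShimuraVarieties, §6 p. 67] [cite: Lange2023AbelianVarietiesComplex, §3.1.2 (3.4)] -/
theorem exists_symplecticGroupOfForm_typeFormOver_eq_map_conj [Algebra ℚ R] (δ : Fin g → ℕ) (hδ : ∀ i, 0 < δ i) :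
    ∃ P : GL (Fin g ⊕ Fin g) R,
      (P : Matrix (Fin g ⊕ Fin g) (Fin g ⊕ Fin g) R) =
          Matrix.fromBlocks (1 : Matrix (Fin g) (Fin g) R) 0 0 (Matrix.diagonal fun i => (δ i : R)) ∧
        symplecticGroupOfForm (typeFormOver δ R) =
          (symplecticGroupOfForm (Matrix.J (Fin g) R)).map (MulAut.conj P⁻¹).toMonoidHom ∧
        similitudeGroupOfForm (typeFormOver δ R) =
          (similitudeGroupOfForm (Matrix.J (Fin g) R)).map (MulAut.conj P⁻¹).toMonoidHom := by
  obtain ⟨u, hu⟩ := exists_units_coe_eq_natCast R δ hδ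
  obtain ⟨P, hP⟩ := exists_generalLinearGroup_coe_eq_fromBlocks R u
  have hP' : (P : Matrix (Fin g ⊕ Fin g) (Fin g ⊕ Fin g) R) =
      Matrix.fromBlocks (1 : Matrix (Fin g) (Fin g) R) 0 0 (Matrix.diagonal fun i => (δ i : R)) := by
    rw [hP]; simp only [hu]
  exact ⟨P, hP', symplecticGroupOfForm_typeFormOver_eq_map_conj R δ u hu P hP,
    similitudeGroupOfForm_typeFormOver_eq_map_conj R δ u hu P hP⟩

/-- **Packaged membership test over a `ℚ`-algebra**: with the `P_δ` above, `x ∈ Sp(E_δ)(R) ↔ P_δ x P_δ⁻¹ ∈ Sp_{2g}(R)`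
(Mathlib's `Matrix.symplecticGroup`) and `x ∈ GSp(E_δ)(R) ↔ P_δ x P_δ⁻¹ ∈ GSp(J)(R)`, for every `x ∈ GL_{2g}(R)`.
[cite: Milne2005ShimuraVarieties, §6 p. 67] -/
theorem exists_forall_mem_typeFormOver_iff [Algebra ℚ R] (δ : Fin g → ℕ) (hδ : ∀ i, 0 < δ i) :
    ∃ P : GL (Fin g ⊕ Fin g) R,
      (P : Matrix (Fin g ⊕ Fin g) (Fin g ⊕ Fin g) R) =
          Matrix.fromBlocks (1 : Matrix (Fin g) (Fin g) R) 0 0 (Matrix.diagonal fun i => (δ i : R)) ∧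
        (∀ x : GL (Fin g ⊕ Fin g) R, x ∈ symplecticGroupOfForm (typeFormOver δ R) ↔
          ((P * x * P⁻¹ : GL (Fin g ⊕ Fin g) R) : Matrix (Fin g ⊕ Fin g) (Fin g ⊕ Fin g) R) ∈
            Matrix.symplecticGroup (Fin g) R) ∧
        (∀ x : GL (Fin g ⊕ Fin g) R, x ∈ similitudeGroupOfForm (typeFormOver δ R) ↔
          P * x * P⁻¹ ∈ similitudeGroupOfForm (Matrix.J (Fin g) R)) := by
  obtain ⟨P, hP, hSp, hGSp⟩ := exists_symplecticGroupOfForm_typeFormOver_eq_map_conj R δ hδ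
  refine ⟨P, hP, fun x => ?_, fun x => ?_⟩
  · rw [hSp, mem_map_conj_inv_iff, mem_symplecticGroupOfForm_J_iff]
  · rw [hGSp, mem_map_conj_inv_iff]

variable {R}

/-- **Functoriality of `P_δ` in the ring**: `GL_{2g}(f)` carries the block matrix `diag(1_g, Δ)` over `R` to the one over
`S` (so `P_δ` over `𝔸_{ℚ,f}` or `ℝ` is the image of the rational `P_δ`, and conjugation by `P_δ` commutes with the
diagonal embeddings `gspRationalToFinAdelic`, `gspRationalToReal`). [cite: Lange2023AbelianVarietiesComplex, §3.1.2 (3.4)]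
[cite: Milne2005ShimuraVarieties, §5 p. 56] -/
theorem generalLinearGroup_map_coe_eq_fromBlocks {S : Type*} [CommRing S] (f : R →+* S) (δ : Fin g → ℕ)
    (P : GL (Fin g ⊕ Fin g) R)
    (hP : (P : Matrix (Fin g ⊕ Fin g) (Fin g ⊕ Fin g) R) =
      Matrix.fromBlocks (1 : Matrix (Fin g) (Fin g) R) 0 0 (Matrix.diagonal fun i => (δ i : R))) :
    ((Matrix.GeneralLinearGroup.map f P : GL (Fin g ⊕ Fin g) S) : Matrix (Fin g ⊕ Fin g) (Fin g ⊕ Fin g) S) =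
      Matrix.fromBlocks (1 : Matrix (Fin g) (Fin g) S) 0 0 (Matrix.diagonal fun i => (δ i : S)) := by
  have h : ((Matrix.GeneralLinearGroup.map f P : GL (Fin g ⊕ Fin g) S) : Matrix (Fin g ⊕ Fin g) (Fin g ⊕ Fin g) S) =
      (P : Matrix (Fin g ⊕ Fin g) (Fin g ⊕ Fin g) R).map f := rfl
  rw [h, hP, Matrix.fromBlocks_map]
  simp [Matrix.diagonal_map (map_zero f)]

end TypeDelta

end Literature.AlgebraicGeometry.ModuliOfAbelianVarieties

end
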